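import Summits.BirchSwinnertonDyer.Rank1Residual.P2.TransportAtTwoShuZhai
import Summits.BirchSwinnertonDyer.Rank1Residual.Partition.Bsdp
import Summits.BirchSwinnertonDyer.Rank1Residual.X12.CMIsogenyInvariance
import Literature.NumberTheory.EllipticCurves.Wuthrich2014.ShaBoundProofs
import Literature.NumberTheory.EllipticCurves.AgasheRibetStein2006.ManinConstantOptimalCurves
import HarnessLib

/-!
# Cell `bsd-print-cf2` (D-0131 (2) PRINT TIER, leaf CornerF @ `p = 2`), seat p2 — Shu–Zhai 2021
# Thm 1.2 / 1.4 / 4.10 FROM A CM BASE: the base certificate is free (row C8), so the rank-ONE twist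
# `E^{(−pM)}` of ANY optimal CM curve in the printed setting gets `ord_{s=1} L = 1 ∧ BSD(·, 2)` BY NAME,
# on every globally minimal model and on the whole `ℚ`-isogeny class

HONEST FRAMING (cell `bsd-print-cf2`, run/shared/lean/pub/bsd-print-cf2/; the partition leaf «CornerF @ `2`» =
`Summit.BirchSwinnertonDyer.WAllCornerFTwo` is OPEN AS A CLASS). This file asserts NO arithmetic fact and
introduces NO definition and NO named fact. It factors the CM-base case out of p3's `36a1` files
(`P2/ShuZhaiThirtySix{Slices,IsogenyClass}.lean`, p3 g0–g2) so that EVERY printed CM base of Shu–Zhai's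
theorems is consumed by the same three lemmas — today `36a1` (`j = 0`, `2` inert; p3) and `256c1` (`j = 1728`,
`2` RAMIFIED; lit g3 DOSSIER §16, tree fact `ShuZhai2021.base256c1_optimal_cuspZero`, p548891; seat p2's
`P2/ShuZhaiTwoFiftySixSlices.lean`):

* §1 `analyticRank_eq_zero_and_bsdp_of_shuZhai_of_hasCM`: in the setting of Thm 1.2 (`Thm12Setting W Dt W′ p Q`)
  the BASE `W` has `ord_{s=1} L(W,s) = 0` (Thm 1.2 at `r = 0`, `P2.base_rankZero_of_shuZhai`) — so if `W` has CM,
  row C8 (Rubin 1991 / Burungale–Flach 2024, tree fact `bsdTriple_of_hasCM_of_L_one_ne_zero`) gives `BSD(W, ℓ)`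
  at EVERY prime `ℓ`: the «certified base» hypothesis of the P2 transport `P2.bsdp_two_twists_of_shuZhai`
  (p3/P2 typer, `P2/TransportAtTwoShuZhai.lean`) is DISCHARGED BY NAME for CM bases;
  `not_two_dvd_c_of_isOptimalDatum_of_conductorNorm_le`: hypothesis (i) of Thm 1.4 («odd Manin constant») from
  Agashe–Ribet–Stein 2006 Thm 2.6 BY NAME whenever `N ≤ 130000`.
* §2 `analyticRank_eq_one_and_bsdp_two_of_rankOneTwist_of_hasCM`: CM base + setting + (i) + (ii) ⇒ every
  globally minimal model of `E^{(−pM)}` has `ord_{s=1} L = 1 ∧ BSD(·,2)`; the rank-zero companion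
  `analyticRank_eq_zero_and_bsdp_two_of_rankZeroTwist_of_hasCM` for `E^{(M)}`; and Thm 4.10's UNCONDITIONAL
  content on the rank-one twist, `sha_odd_and_ordTwo_of_rankOneTwist` (`Ш` finite of odd order,
  `ord₂(L′/(Ω R)) = #Q`) — the «2-adic valuation of the L-value» half of the seat's sentence, in print.
* §3 the `ℚ`-ISOGENY CLASS: `analyticRank_eq_one_and_bsdp_two_of_isIsogenous_rankOneTwist_of_hasCM` (Cassels'
  invariance `bsdRHS_eq_of_isIsogenous` BY NAME — conjunct 3 of both bundles `𝔅_ram`, `𝔅_inert` of route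
  `PrintCf2` —, tree `Wuthrich2014.bsdp_of_isIsogenous`, Faltings `analyticRank_eq_of_isIsogenous'`), and CM /
  the CM field along models and isogenies of twists (`hasCM_of_smul_quadraticTwist_of_hasCM`,
  `hasCM_of_isIsogenous_quadraticTwist_of_hasCM`, `cmRamified_iff_of_smul_quadraticTwist`).

Binders displayed, nothing else: `thm12_ranks_of_twists` (SZ Thm 1.2), `thm14_twoPartBSD_of_twists` (Thm 1.4),
`thm410_twoAdicValuations_of_twists` (Thm 4.10), `bsdTriple_of_hasCM_of_L_one_ne_zero` (row C8),
`hasEntireLFunction_rat` (modularity), `bsdRHS_eq_of_isIsogenous` (Cassels),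
`AgasheRibetStein2006.cremona_abs_maninConstant_eq_one_of_level_le` (ARS06) — and the printed setting data
(`Dt`, `IsOptimalDatum`, `CuspZeroNotInTwice`, (Tor), isogeny, Heegner / admissibility conditions) packed in
`Thm12Setting`. beyond-print theorem: NO (Shu–Zhai's printed theorems read on the leaf; the CM base certificate
is Rubin's theorem). Seat p2 strategy sentence: «2-descent matrix road … + Coates–Li–Tian–Zhai 2015 / Zhao
2-adic valuation of L(E,1)/Ω ⇒ 2-part of BSD family-wide» — Shu–Zhai 2021 is the rank-one sequel of CLTZ15
(2-isogeny descent with admissible primes + Zhao induction on 2-adic valuations of Heegner points).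

References: [ShuZhai2021] Thm 1.2, Thm 1.4, Thm 4.10 (arXiv:2102.11808 chunks p0003 L24–L45, p0013
L14–L26); [BurungaleFlach2024] Thm 1.1, Cor 2; [AgasheRibetStein2006] Thm 2.6; [MilneADT2006] Thm I.7.3
(Cassels); [Miller2011LMS] Def 1.1; [SilvermanAEC2009] III.1.4(b), X.5 Cor 5.4, Cor III.9.4; tree files
`P2/TransportAtTwoShuZhai.lean`, `Partition/Bsdp.lean` (`RowC8.bsdp`), `X12/CMIsogenyInvariance.lean`.
-/

noncomputable section

open scoped Classical

open WeierstrassCurve NumberField Literature.NumberTheory.EllipticCurves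
  Literature.NumberTheory.EllipticCurves.Rank1Residual
  Literature.NumberTheory.EllipticCurves.ModularForms
  Literature.NumberTheory.EllipticCurves.ShuZhai2021
  Summit.BirchSwinnertonDyer.Rank1Residual

set_option autoImplicit false

namespace Summit.BirchSwinnertonDyer.Rank1Residual.P2

section CMBase

variable {W : WeierstrassCurve ℚ} [W.IsElliptic] [W.IsGloballyMinimal] [NeZero (W.conductorNorm ℤ)]
  {Dt : ModularParametrizationData W (W.conductorNorm ℤ)} {W' : WeierstrassCurve ℚ} {p : ℕ}
  {Q : Finset ℕ}

/-! ## §1 The CM base: analytic rank `0` (Thm 1.2 at `r = 0`) and `BSD(W, ℓ)` at every prime (row C8) -/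

/-- **A CM base of the Shu–Zhai setting satisfies `ord_{s=1} L(W,s) = 0` and `BSD(W, ℓ)` at EVERY prime `ℓ`.**
The analytic rank is Shu–Zhai Thm 1.2 at `r = 0` (`h12`; in print "`f([0]) ∉ 2E(ℚ)` forces `L(E,1) ≠ 0`",
tree `P2.base_rankZero_of_shuZhai`); `BSD(W, ℓ)` is then row C8 — Rubin 1991 / Burungale–Flach 2024 for CM
curves with `L(E,1) ≠ 0` (`hCM` = `bsdTriple_of_hasCM_of_L_one_ne_zero`, modularity `hmod`), tree
`RowC8.bsdp`. [cite: ShuZhai2021, Thm. 1.2 (arXiv:2102.11808 chunk p0003 L24–L32)]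
[cite: BurungaleFlach2024, Thm. 1.1 and Cor. 2 (p. 4)] [cite: Miller2011LMS, Def. 1.1] -/
theorem analyticRank_eq_zero_and_bsdp_of_shuZhai_of_hasCM (h12 : thm12_ranks_of_twists)
    (hCM : bsdTriple_of_hasCM_of_L_one_ne_zero) (hmod : hasEntireLFunction_rat)
    (hS : Thm12Setting W Dt W' p Q) (hW : W.HasCM) (ℓ : ℕ) [Fact ℓ.Prime] :
    W.analyticRank = 0 ∧ BSDp W ℓ :=
  have hr := (base_rankZero_of_shuZhai h12 hS).1
  ⟨hr, RowC8.bsdp hCM hmod ⟨hW, hr⟩⟩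

omit [NeZero (W.conductorNorm ℤ)] in
/-- **Hypothesis (i) of Thm 1.4 ("the Manin constant of `E` is odd") BY NAME** for an optimal base of conductor
`≤ 130000`: Agashe–Ribet–Stein 2006 Thm 2.6 (Cremona: `c_E = 1` for every optimal curve of conductor
`≤ 130000`; `hARS` = tree fact `AgasheRibetStein2006.cremona_abs_maninConstant_eq_one_of_level_le`) gives
`|c| = 1`, hence `2 ∤ c`, for any parametrisation datum with the lattice equality (`IsOptimalDatum`).
[cite: AgasheRibetStein2006, Thm. 2.6 (p. 619)] -/
theorem not_two_dvd_c_of_isOptimalDatum_of_conductorNorm_le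
    (hARS : AgasheRibetStein2006.cremona_abs_maninConstant_eq_one_of_level_le) {N : ℕ} [NeZero N]
    (D : ModularParametrizationData W N) (hopt : IsOptimalDatum W D) (hN : N ≤ 130000) :
    ¬ (2 : ℤ) ∣ D.c := by
  exact_mod_cast AgasheRibetStein2006.not_dvd_maninConstant_of_level_le hARS W D hopt hN Nat.prime_two

/-! ## §2 The twists of a CM base: Thm 1.2 + Thm 1.4 with the base certificate discharged; Thm 4.10 -/

/-- **`ord_{s=1} L = 1 ∧ BSD(·, 2)` for every globally minimal model of the rank-ONE twist `E^{(−pM)}` of a CM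
base.** Hypotheses BY NAME / as printed: Shu–Zhai Thm 1.2 (`h12`), Thm 1.4 (`h14`), row C8 (`hCM`), modularity
(`hmod`); the setting of Thm 1.2 (`hS`), `W` CM (`hW`), (i) odd Manin constant (`hc`), (ii) every `ℓ ∣ 2N`
split in `ℚ(√−p)` (`hK`) and in `ℚ(√M)` (`hQM`), `M = ∏_{q∈Q} q*`. Proof: `P2.bsdp_two_twists_of_shuZhai`
with the certified base of §1 (a globally minimal model of the rank-zero companion `E^{(M)}` exists, Silverman
VIII.8.3, its conclusions are dropped). [cite: ShuZhai2021, Thm. 1.2 and Thm. 1.4 (arXiv:2102.11808 chunk p0003 L24–L45)]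
[cite: BurungaleFlach2024, Cor. 2] [cite: Miller2011LMS, Def. 1.1] -/
theorem analyticRank_eq_one_and_bsdp_two_of_rankOneTwist_of_hasCM (h12 : thm12_ranks_of_twists)
    (h14 : thm14_twoPartBSD_of_twists) (hCM : bsdTriple_of_hasCM_of_L_one_ne_zero)
    (hmod : hasEntireLFunction_rat) (hS : Thm12Setting W Dt W' p Q) (hW : W.HasCM)
    (hc : ¬ (2 : ℤ) ∣ Dt.c) (hK : AllPrimesSplitInSqrt (2 * W.conductorNorm ℤ) (-(p : ℤ)))
    (hQM : AllPrimesSplitInSqrt (2 * W.conductorNorm ℤ) (∏ q ∈ Q, qStar q))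
    (WpM : WeierstrassCurve ℚ) [WpM.IsElliptic] [WpM.IsGloballyMinimal]
    (hWpM : ∃ C : VariableChange ℚ,
      C • W.quadraticTwist ((-(p : ℤ) * ∏ q ∈ Q, qStar q : ℤ) : ℚ) = WpM) :
    WpM.analyticRank = 1 ∧ BSDp WpM 2 := by
  have hd : ((∏ q ∈ Q, qStar q : ℤ) : ℚ) ≠ 0 := by
    have h := neg_p_mul_ne_zero_of_thm12Setting hS Q
      (fun q hq => by exact_mod_cast (hS.2.2.2.2.2.2.2.2.2 q hq).1.1.ne_zero)
    push_cast at h ⊢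
    exact (mul_ne_zero_iff.mp h).2
  obtain ⟨WM, _, _, hWM⟩ := exists_globallyMinimal_twist W hd
  exact (bsdp_two_twists_of_shuZhai h12 h14 hmod hS hWM hWpM hc hK hQM
    (analyticRank_eq_zero_and_bsdp_of_shuZhai_of_hasCM h12 hCM hmod hS hW 2).2).2

/-- **The rank-ZERO companion `E^{(M)}` of a CM base: `ord_{s=1} L = 0 ∧ BSD(·, 2)`** on every globally minimal
model, same named hypotheses (a globally minimal model of `E^{(−pM)}` exists and its conclusions are dropped).
(Each such twist is itself CM with `L ≠ 0`, so row C8 alone would also do; recorded for symmetry.)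
[cite: ShuZhai2021, Thm. 1.2 and Thm. 1.4] [cite: BurungaleFlach2024, Cor. 2] [cite: Miller2011LMS, Def. 1.1] -/
theorem analyticRank_eq_zero_and_bsdp_two_of_rankZeroTwist_of_hasCM (h12 : thm12_ranks_of_twists)
    (h14 : thm14_twoPartBSD_of_twists) (hCM : bsdTriple_of_hasCM_of_L_one_ne_zero)
    (hmod : hasEntireLFunction_rat) (hS : Thm12Setting W Dt W' p Q) (hW : W.HasCM)
    (hc : ¬ (2 : ℤ) ∣ Dt.c) (hK : AllPrimesSplitInSqrt (2 * W.conductorNorm ℤ) (-(p : ℤ)))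
    (hQM : AllPrimesSplitInSqrt (2 * W.conductorNorm ℤ) (∏ q ∈ Q, qStar q))
    (WM : WeierstrassCurve ℚ) [WM.IsElliptic] [WM.IsGloballyMinimal]
    (hWM : ∃ C : VariableChange ℚ, C • W.quadraticTwist ((∏ q ∈ Q, qStar q : ℤ) : ℚ) = WM) :
    WM.analyticRank = 0 ∧ BSDp WM 2 := by
  have hd : ((-(p : ℤ) * ∏ q ∈ Q, qStar q : ℤ) : ℚ) ≠ 0 :=
    neg_p_mul_ne_zero_of_thm12Setting hS Q
      (fun q hq => by exact_mod_cast (hS.2.2.2.2.2.2.2.2.2 q hq).1.1.ne_zero)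
  obtain ⟨WpM, _, _, hWpM⟩ := exists_globallyMinimal_twist W hd
  exact (bsdp_two_twists_of_shuZhai h12 h14 hmod hS hWM hWpM hc hK hQM
    (analyticRank_eq_zero_and_bsdp_of_shuZhai_of_hasCM h12 hCM hmod hS hW 2).2).1

omit [W.IsElliptic] [W.IsGloballyMinimal] in
/-- **Shu–Zhai Thm 4.10 on the rank-ONE twist, UNCONDITIONAL content** (no base certificate, no CM needed): in
the setting of Thm 1.2 with every `ℓ ∣ 2N` split in `ℚ(√M)`, `p ≡ 7 (mod 8)` and odd Manin constant, every
globally minimal model `WpM` of `E^{(−pM)}` has `ord_{s=1} L = rank = 1`, `Ш(WpM)` FINITE OF ODD ORDER, and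
`L′(WpM, 1) = x · Ω · R` with `x ∈ ℚ`, `ord₂ x = #Q` — the printed `2`-adic valuation of the leading
coefficient. (`h410` = `thm410_twoAdicValuations_of_twists`; a globally minimal model of `E^{(M)}` exists and
its clauses are dropped.) [cite: ShuZhai2021, Thm. 4.10 (arXiv:2102.11808 chunk p0013 L14–L26)] -/
theorem sha_odd_and_ordTwo_of_rankOneTwist [W.IsElliptic] [W.IsGloballyMinimal]
    (h410 : thm410_twoAdicValuations_of_twists) (hS : Thm12Setting W Dt W' p Q)
    (hQM : AllPrimesSplitInSqrt (2 * W.conductorNorm ℤ) (∏ q ∈ Q, qStar q)) (hp8 : p % 8 = 7)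
    (hc : ¬ (2 : ℤ) ∣ Dt.c) (WpM : WeierstrassCurve ℚ) [WpM.IsElliptic] [WpM.IsGloballyMinimal]
    (hWpM : ∃ C : VariableChange ℚ,
      C • W.quadraticTwist ((-(p : ℤ) * ∏ q ∈ Q, qStar q : ℤ) : ℚ) = WpM) :
    (WpM.analyticRank = 1 ∧ WpM.mordellWeilRank = 1) ∧ (Finite WpM.sha ∧ Odd (Nat.card WpM.sha)) ∧
      ∃ x : ℚ, WpM.leadingLCoeff = (x : ℂ) * (WpM.realPeriodRat : ℂ) * (WpM.regulator : ℂ) ∧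
        padicValRat 2 x = (Q.card : ℤ) := by
  have hd : ((∏ q ∈ Q, qStar q : ℤ) : ℚ) ≠ 0 := by
    have h := neg_p_mul_ne_zero_of_thm12Setting hS Q
      (fun q hq => by exact_mod_cast (hS.2.2.2.2.2.2.2.2.2 q hq).1.1.ne_zero)
    push_cast at h ⊢
    exact (mul_ne_zero_iff.mp h).2
  obtain ⟨WM, _, _, hWM⟩ := exists_globallyMinimal_twist W hd
  obtain ⟨⟨-, -, hr1, hrk1⟩, -, hval, ⟨-, -, hfin, hodd⟩, -⟩ :=
    h410 W Dt W' p Q hS hQM hp8 hc WM WpM hWM hWpM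
  exact ⟨⟨hr1, hrk1⟩, ⟨hfin, hodd⟩, hval⟩

/-! ## §3 Along `ℚ`-isomorphisms and `ℚ`-isogenies: the class of the twist; CM and the CM field -/

omit [W.IsGloballyMinimal] [NeZero (W.conductorNorm ℤ)] in
/-- **CM along a model of a twist**: if `W` has CM then every elliptic `ℚ`-model of `W^{(d)}` (`d ≠ 0`) has CM
(`j` is invariant under twists and `ℚ`-isomorphisms; `HasCM` depends on `j` only).
[cite: SilvermanAEC2009, III.1 Prop. 1.4(b) and X.5 Cor. 5.4] -/
theorem hasCM_of_smul_quadraticTwist_of_hasCM (hW : W.HasCM) {d : ℚ} (hd : d ≠ 0) {V : WeierstrassCurve ℚ}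
    [V.IsElliptic] {C : VariableChange ℚ} (hC : C • W.quadraticTwist d = V) : V.HasCM := by
  haveI := W.isElliptic_quadraticTwist hd
  have hj : V.j = W.j := by subst hC; rw [variableChange_j, j_quadraticTwist _ hd]
  exact (hasCM_iff_of_j_eq hj).2 hW

omit [W.IsGloballyMinimal] [NeZero (W.conductorNorm ℤ)] in
/-- **The CM prime type along a model of a twist**: `ℓ` ramified in the CM field of a model of `W^{(d)}` iff
in that of `W` (both read `ℓ ∣ d_K(j)`, same `j`). [cite: SilvermanAEC2009, X.5 Cor. 5.4] -/
theorem cmRamified_iff_of_smul_quadraticTwist {d : ℚ} (hd : d ≠ 0) {V : WeierstrassCurve ℚ} [V.IsElliptic]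
    {C : VariableChange ℚ} (hC : C • W.quadraticTwist d = V) (ℓ : ℕ) : CMRamified V ℓ ↔ CMRamified W ℓ := by
  haveI := W.isElliptic_quadraticTwist hd
  have hj : V.j = W.j := by subst hC; rw [variableChange_j, j_quadraticTwist _ hd]
  unfold CMRamified
  rw [hj]

omit [W.IsGloballyMinimal] [NeZero (W.conductorNorm ℤ)] in
/-- **CM along an isogeny to a twist**: if `W` has CM then every elliptic `V` `ℚ`-isogenous to `W^{(d)}` has CM
(`X12.hasCM_of_isIsogenous`), and `ℓ` is ramified in the CM field of `V` iff in that of `W`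
(`X12.cmRamified_iff_of_isIsogenous`). [cite: SilvermanAEC2009, Cor. III.9.4 and III.6] -/
theorem hasCM_and_cmRamified_iff_of_isIsogenous_quadraticTwist_of_hasCM (hW : W.HasCM) {d : ℚ} (hd : d ≠ 0)
    (V : WeierstrassCurve ℚ) [V.IsElliptic] (hiso : IsIsogenous V (W.quadraticTwist d)) (ℓ : ℕ) :
    V.HasCM ∧ (CMRamified V ℓ ↔ CMRamified W ℓ) := by
  haveI := W.isElliptic_quadraticTwist hd
  have h1 : (1 : VariableChange ℚ) • W.quadraticTwist d = W.quadraticTwist d := one_smul _ _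
  have hT : (W.quadraticTwist d).HasCM := hasCM_of_smul_quadraticTwist_of_hasCM hW hd h1
  have hV : V.HasCM := X12.hasCM_of_isIsogenous hiso.symm_of_charZero hT
  exact ⟨hV, (X12.cmRamified_iff_of_isIsogenous hiso hV ℓ).trans (cmRamified_iff_of_smul_quadraticTwist hd h1 ℓ)⟩

/-- **`ord_{s=1} L = 1 ∧ BSD(V, 2)` for every globally minimal `V` that is `ℚ`-ISOGENOUS to the rank-one twist
`E^{(−pM)}` of a CM base**: §2 on a globally minimal model `WpM` of the twist (Silverman VIII.8.3), then
Cassels' isogeny invariance BY NAME (`hCassels` = `bsdRHS_eq_of_isIsogenous`, tree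
`Wuthrich2014.bsdp_of_isIsogenous`; `Ш(WpM)` finite by Thm 1.2, `L′(WpM,1) ≠ 0` by modularity) and Faltings
(`analyticRank_eq_of_isIsogenous'`). [cite: ShuZhai2021, Thm. 1.2 and Thm. 1.4]
[cite: MilneADT2006, Thm. I.7.3] [cite: Miller2011LMS, §1 and Def. 1.1] [cite: BurungaleFlach2024, Cor. 2] -/
theorem analyticRank_eq_one_and_bsdp_two_of_isIsogenous_rankOneTwist_of_hasCM
    (hCassels : bsdRHS_eq_of_isIsogenous) (h12 : thm12_ranks_of_twists)
    (h14 : thm14_twoPartBSD_of_twists) (hCM : bsdTriple_of_hasCM_of_L_one_ne_zero)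
    (hmod : hasEntireLFunction_rat) (hS : Thm12Setting W Dt W' p Q) (hW : W.HasCM)
    (hc : ¬ (2 : ℤ) ∣ Dt.c) (hK : AllPrimesSplitInSqrt (2 * W.conductorNorm ℤ) (-(p : ℤ)))
    (hQM : AllPrimesSplitInSqrt (2 * W.conductorNorm ℤ) (∏ q ∈ Q, qStar q))
    (V : WeierstrassCurve ℚ) [V.IsElliptic] [V.IsGloballyMinimal]
    (hiso : IsIsogenous V (W.quadraticTwist ((-(p : ℤ) * ∏ q ∈ Q, qStar q : ℤ) : ℚ))) :
    V.analyticRank = 1 ∧ BSDp V 2 := by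
  have hd0 : ((-(p : ℤ) * ∏ q ∈ Q, qStar q : ℤ) : ℚ) ≠ 0 :=
    neg_p_mul_ne_zero_of_thm12Setting hS Q
      (fun q hq => by exact_mod_cast (hS.2.2.2.2.2.2.2.2.2 q hq).1.1.ne_zero)
  have hd : ((∏ q ∈ Q, qStar q : ℤ) : ℚ) ≠ 0 := by
    have h := hd0
    push_cast at h ⊢
    exact (mul_ne_zero_iff.mp h).2
  haveI := W.isElliptic_quadraticTwist hd0
  obtain ⟨WpM, _, _, C, hC⟩ := exists_globallyMinimal_twist W hd0
  obtain ⟨hr, hbsd⟩ := analyticRank_eq_one_and_bsdp_two_of_rankOneTwist_of_hasCM h12 h14 hCM hmod hS hW hc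
    hK hQM WpM ⟨C, hC⟩
  -- `V ∼ W^{(−pM)} ≅ WpM`
  have hiso' : IsIsogenous V WpM := hiso.trans' (by rw [← hC]; exact isIsogenous_smul _ C)
  -- `Ш(WpM)` finite (Thm 1.2) and `L′(WpM, 1) ≠ 0` (modularity)
  obtain ⟨WM, _, _, hWM⟩ := exists_globallyMinimal_twist W hd
  obtain ⟨-, -, -, -, -, hfin⟩ := h12 W Dt W' p Q hS WM WpM hWM ⟨C, hC⟩
  haveI := hfin
  exact ⟨(analyticRank_eq_of_isIsogenous' hiso').trans hr,
    Wuthrich2014.bsdp_of_isIsogenous hCassels hiso' hfin (WpM.leadingLCoeff_ne_zero_holds (hmod WpM)) hbsd⟩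

end CMBase

end Summit.BirchSwinnertonDyer.Rank1Residual.P2

end
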